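import Summits.BirchSwinnertonDyer.BirchSwinnertonDyer.Theorems.KolyvaginDepthDoorMSymbolCertCosetsC
import HarnessLib

/-!
# Route `KolyvaginDepthDoor`, crux `KolyvaginDepthSupplyKN` (stmt-BirchSwinnertonDyer-22820) —
# DEPTH TABLE v28, KIT 1′ (composite level `N = q₁ q₂`), part 2: the M-symbol relations in pair-index form

Helper file of the lead prover of line `levelone` (kdd-p1 g33; `--supports stmt-BirchSwinnertonDyer-22820
--as helper`); it closes nothing and BSD is NOT proved by it. Sequel of `…MSymbolCertCosetsC`:
`ΨC f i = re [eC i]_f`, `ΨmC f i = im [eC i]_f` for `f ∈ S₂(Γ₀(q₁q₂))` and the two-term / three-term /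
conjugation / Popa–Zagier Hecke relations `relC_two/three/iota/hecke`, `relImC_two/three/iota/hecke` (as kits 1 and 5,
from the tree's PROVED M-symbol relations `msymbol_add_msymbol_S_inv_smul`, `msymbol_three_term`,
`modularSymbol_neg_eq_conj_holds`, `finsum_smul_msymbol_eq`), the conjugation lemmas being re-proved at an arbitrary level.

References: [CremonaAlgorithms1997] §2.1.4, §2.2; [PopaZagier2017] Thm. 1, §5.
-/

set_option linter.dupNamespace false

noncomputable section

open scoped MatrixGroups ModularForm
open CongruenceSubgroup ModularGroup Matrix
open Literature.NumberTheory.EllipticCurves Literature.NumberTheory.EllipticCurves.ModularForms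
open Literature.NumberTheory.Automorphic.PopaZagier (coeffN coeff coeff12 coeff12M coeffN_det
  finite_support_coeffN orbT_zeta0_coeffN_eq)

namespace Summit.BirchSwinnertonDyer.BirchSwinnertonDyer.Theorems.KolyvaginDepthDoor.MSymbolCert

section CPrime

variable {q₁ q₂ : ℕ} [h₁ : Fact q₁.Prime] [h₂ : Fact q₂.Prime] [hne : Fact (q₁ ≠ q₂)]

/-! ## Real and imaginary parts of the M-symbols and their relations in index form -/

variable (f : CuspForm (Gamma0 (q₁ * q₂)) 2)

/-- `ΨC f i = re [eC i]_f`. [cite: CremonaAlgorithms1997, §2.2] -/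
def ΨC (i : ℕ) : ℝ := ((msymbol (q₁ * q₂) (eC q₁ q₂ i)) f).re

/-- `ΨmC f i = im [eC i]_f`. [cite: CremonaAlgorithms1997, §2.2] -/
def ΨmC (i : ℕ) : ℝ := ((msymbol (q₁ * q₂) (eC q₁ q₂ i)) f).im

/-- **Two-term relation** `Ψ i + Ψ (sCN i) = 0`. [cite: CremonaAlgorithms1997, §2.2 (2.2.5)] -/
theorem relC_two (i : ℕ) : ΨC f i + ΨC f (sCN q₁ q₂ i) = 0 := by
  have h := congrArg (fun φ : Module.Dual ℂ (CuspForm (Gamma0 (q₁ * q₂)) 2) => (φ f).re)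
    (msymbol_add_msymbol_S_inv_smul (N := q₁ * q₂) (eC q₁ q₂ i))
  simp only [LinearMap.add_apply, Complex.add_re, LinearMap.zero_apply, Complex.zero_re] at h
  rw [inv_smul_eC, ← sCN_eq] at h
  exact h

/-- Two-term relation, imaginary parts. [cite: CremonaAlgorithms1997, §2.2 (2.2.5)] -/
theorem relImC_two (i : ℕ) : ΨmC f i + ΨmC f (sCN q₁ q₂ i) = 0 := by
  have h := congrArg (fun φ : Module.Dual ℂ (CuspForm (Gamma0 (q₁ * q₂)) 2) => (φ f).im)
    (msymbol_add_msymbol_S_inv_smul (N := q₁ * q₂) (eC q₁ q₂ i))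
  simp only [LinearMap.add_apply, Complex.add_im, LinearMap.zero_apply, Complex.zero_im] at h
  rw [inv_smul_eC, ← sCN_eq] at h
  exact h

/-- **Three-term relation** `Ψ i + Ψ (uCN i) + Ψ (uCN (uCN i)) = 0`. [cite: CremonaAlgorithms1997, §2.2 (2.2.6)] -/
theorem relC_three (i : ℕ) : ΨC f i + ΨC f (uCN q₁ q₂ i) + ΨC f (uCN q₁ q₂ (uCN q₁ q₂ i)) = 0 := by
  have h := congrArg (fun φ : Module.Dual ℂ (CuspForm (Gamma0 (q₁ * q₂)) 2) => (φ f).re)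
    (msymbol_three_term (N := q₁ * q₂) (eC q₁ q₂ i))
  simp only [LinearMap.add_apply, Complex.add_re, LinearMap.zero_apply, Complex.zero_re] at h
  rw [pow_two, mul_smul, inv_smul_eC, Matrix.SpecialLinearGroup.coe_mul, ← uCN_eq, inv_smul_eC,
    Matrix.SpecialLinearGroup.coe_mul, ← uCN_eq] at h
  exact h

/-- Three-term relation, imaginary parts. [cite: CremonaAlgorithms1997, §2.2 (2.2.6)] -/
theorem relImC_three (i : ℕ) : ΨmC f i + ΨmC f (uCN q₁ q₂ i) + ΨmC f (uCN q₁ q₂ (uCN q₁ q₂ i)) = 0 := by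
  have h := congrArg (fun φ : Module.Dual ℂ (CuspForm (Gamma0 (q₁ * q₂)) 2) => (φ f).im)
    (msymbol_three_term (N := q₁ * q₂) (eC q₁ q₂ i))
  simp only [LinearMap.add_apply, Complex.add_im, LinearMap.zero_apply, Complex.zero_im] at h
  rw [pow_two, mul_smul, inv_smul_eC, Matrix.SpecialLinearGroup.coe_mul, ← uCN_eq, inv_smul_eC,
    Matrix.SpecialLinearGroup.coe_mul, ← uCN_eq] at h
  exact h

omit hne in
/-- `{∞, (conjNeg k)∞} = conj {∞, k∞}` for real Fourier coefficients (kit 1's `inftySymbol_conjNeg`, any level).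
[cite: CremonaAlgorithms1997, §2.1.4] -/
theorem inftySymbol_conjNeg' (hreal : ∀ n, (cuspCoeff f n).im = 0) (k : SL(2, ℤ)) :
    inftySymbol f (conjNeg k) = starRingEnd ℂ (inftySymbol f k) := by
  unfold inftySymbol
  simp only [conjNeg_apply_10, conjNeg_apply_00, neg_eq_zero]
  split_ifs with h
  · simp
  · rw [← modularSymbol_neg_eq_conj_holds f hreal]
    congr 1
    push_cast
    rw [div_neg]

omit hne in
/-- `[conjNeg k]_f = conj [k]_f` for real Fourier coefficients (kit 1's `msymbolSL_conjNeg`, any level).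
[cite: CremonaAlgorithms1997, §2.1.4] -/
theorem msymbolSL_conjNeg' (hreal : ∀ n, (cuspCoeff f n).im = 0) (k : SL(2, ℤ)) :
    msymbolSL f (conjNeg k) = starRingEnd ℂ (msymbolSL f k) := by
  unfold msymbolSL
  have h2 : inftySymbol f (conjNeg k * S) = inftySymbol f (conjNeg (k * S)) := by
    refine inftySymbol_eq_of_apply_eq f (-1) (Or.inr rfl) ?_ ?_ <;>
      simp [conjNeg, ModularGroup.S, Matrix.mul_apply, Fin.sum_univ_two]
  rw [map_sub, h2, inftySymbol_conjNeg' f hreal, inftySymbol_conjNeg' f hreal]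

omit hne in
/-- `[(conjNeg g)Γ₀]_f = conj [gΓ₀]_f` for real Fourier coefficients (kit 1's `msymbol_mk_conjNeg`, any level).
[cite: CremonaAlgorithms1997, §2.1.4] -/
theorem msymbol_mk_conjNeg' (hreal : ∀ n, (cuspCoeff f n).im = 0) (g : SL(2, ℤ)) :
    (msymbol (q₁ * q₂) ((conjNeg g : SL(2, ℤ)) : Gamma0Coset (q₁ * q₂))) f =
      starRingEnd ℂ ((msymbol (q₁ * q₂) (g : Gamma0Coset (q₁ * q₂))) f) := by
  rw [msymbol_mk, msymbol_mk, msymbolFunctional_apply, msymbolFunctional_apply, ← conjNeg_inv,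
    msymbolSL_conjNeg' f hreal]

/-- `[eC (iotaCN i)]_f = conj [eC i]_f` for real Fourier coefficients (conjugate representative). [cite: CremonaAlgorithms1997, §2.1.4] -/
theorem msymbol_eC_iotaCN (hreal : ∀ n, (cuspCoeff f n).im = 0) (i : ℕ) :
    (msymbol (q₁ * q₂) (eC q₁ q₂ (iotaCN q₁ q₂ i))) f =
      starRingEnd ℂ ((msymbol (q₁ * q₂) (eC q₁ q₂ i)) f) := by
  obtain ⟨g, hg, hgi⟩ := exists_rep_eC q₁ q₂ i
  have h00 : ((g 0 0 : ℤ) : ZMod (q₁ * q₂)) = colC q₁ q₂ i 0 := by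
    have := congrArg (fun v : UniCol (q₁ * q₂) => v.1 0) hg; simpa [firstCol, colUC] using this
  have h10 : ((g 1 0 : ℤ) : ZMod (q₁ * q₂)) = colC q₁ q₂ i 1 := by
    have := congrArg (fun v : UniCol (q₁ * q₂) => v.1 1) hg; simpa [firstCol, colUC] using this
  have hconj : ((conjNeg g : SL(2, ℤ)) : Gamma0Coset (q₁ * q₂)) = eC q₁ q₂ (iotaCN q₁ q₂ i) := by
    rw [mk_eq_eC, iotaCN_eq, conjNeg_apply_00, conjNeg_apply_10, Int.cast_neg, h00, h10]
  rw [← hconj, msymbol_mk_conjNeg' f hreal g, hgi]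

/-- **Conjugation relation**: `Ψ (iotaCN i) = Ψ i`. [cite: CremonaAlgorithms1997, §2.1.4] -/
theorem relC_iota (hreal : ∀ n, (cuspCoeff f n).im = 0) (i : ℕ) : ΨC f (iotaCN q₁ q₂ i) = ΨC f i := by
  unfold ΨC
  rw [msymbol_eC_iotaCN f hreal, Complex.conj_re]

/-- **Conjugation is odd on imaginary parts**: `Ψ⁻ (iotaCN i) = −Ψ⁻ i`. [cite: CremonaAlgorithms1997, §2.1.4] -/
theorem relImC_iota (hreal : ∀ n, (cuspCoeff f n).im = 0) (i : ℕ) : ΨmC f (iotaCN q₁ q₂ i) = -ΨmC f i := by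
  unfold ΨmC
  rw [msymbol_eC_iotaCN f hreal, Complex.conj_im]

/-- **Hecke relation in index form** (as kit 1's `rel_hecke`): for `T_n f = a f`, `(n, q₁q₂) = 1` and `H ⊇ supp ξ_n`
of determinant-`n` matrices, `∑_{M ∈ H} ξ_n(M) Ψ(actIdxC M i) = 2 a Ψ i`. [cite: PopaZagier2017, Thm. 1, §5] -/
theorem relC_hecke {n : ℕ} (hn : 0 < n) (hnN : n.Coprime (q₁ * q₂)) {a : ℝ}
    (hT : heckeTnGamma0 (q₁ * q₂) 2 n f = (a : ℂ) • f)
    (H : Finset (Matrix (Fin 2) (Fin 2) ℤ)) (hH : Function.support (coeffN n) ⊆ ↑H)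
    (hdet : ∀ M ∈ H, M.det = n) (i : ℕ) :
    ∑ M ∈ H, (coeffN n M : ℝ) * ΨC f (actIdxC q₁ q₂ M i) = 2 * a * ΨC f i := by
  have hn' : (0 : ℤ) < n := by exact_mod_cast hn
  have key := finsum_smul_msymbol_eq f hn hnN (finite_support_coeffN n) (fun M hM => coeffN_det hM)
    (fun M hM => orbT_zeta0_coeffN_eq hn' hM) (eC q₁ q₂ i)
  rw [finsum_eq_sum_of_support_subset _ (s := H) ?_] at key
  swap
  · intro M hM
    exact hH (Function.support_smul_subset_left _ _ hM)
  rw [hT, map_smul] at key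
  have key' := congrArg Complex.re key
  rw [Complex.re_sum] at key'
  have hunit : IsUnit (((n : ℤ) : ℤ) : ZMod (q₁ * q₂)) := by
    rw [Int.cast_natCast]; exact (ZMod.isUnit_iff_coprime n (q₁ * q₂)).mpr hnN
  have hterm : ∀ M ∈ H, (coeffN n M • (msymbol (q₁ * q₂) (actP (q₁ * q₂) (eC q₁ q₂ i) M.adjugate)) f).re =
      (coeffN n M : ℝ) * ΨC f (actIdxC q₁ q₂ M i) := by
    intro M hM
    have hM : IsUnit ((M.det : ℤ) : ZMod (q₁ * q₂)) := by rw [hdet M hM]; exact hunit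
    rw [actP_eC_adjugate q₁ q₂ hM, Complex.smul_re, Rat.smul_def, ΨC]
  rw [Finset.sum_congr rfl hterm] at key'
  rw [key', Complex.smul_re, smul_eq_mul, Complex.re_ofReal_mul, ΨC, Rat.smul_def]
  push_cast
  ring

/-- Hecke relation, imaginary parts. [cite: PopaZagier2017, Thm. 1, §5] -/
theorem relImC_hecke {n : ℕ} (hn : 0 < n) (hnN : n.Coprime (q₁ * q₂)) {a : ℝ}
    (hT : heckeTnGamma0 (q₁ * q₂) 2 n f = (a : ℂ) • f)
    (H : Finset (Matrix (Fin 2) (Fin 2) ℤ)) (hH : Function.support (coeffN n) ⊆ ↑H)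
    (hdet : ∀ M ∈ H, M.det = n) (i : ℕ) :
    ∑ M ∈ H, (coeffN n M : ℝ) * ΨmC f (actIdxC q₁ q₂ M i) = 2 * a * ΨmC f i := by
  have hn' : (0 : ℤ) < n := by exact_mod_cast hn
  have key := finsum_smul_msymbol_eq f hn hnN (finite_support_coeffN n) (fun M hM => coeffN_det hM)
    (fun M hM => orbT_zeta0_coeffN_eq hn' hM) (eC q₁ q₂ i)
  rw [finsum_eq_sum_of_support_subset _ (s := H) ?_] at key
  swap
  · intro M hM
    exact hH (Function.support_smul_subset_left _ _ hM)
  rw [hT, map_smul] at key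
  have key' := congrArg Complex.im key
  rw [Complex.im_sum] at key'
  have hunit : IsUnit (((n : ℤ) : ℤ) : ZMod (q₁ * q₂)) := by
    rw [Int.cast_natCast]; exact (ZMod.isUnit_iff_coprime n (q₁ * q₂)).mpr hnN
  have hterm : ∀ M ∈ H, (coeffN n M • (msymbol (q₁ * q₂) (actP (q₁ * q₂) (eC q₁ q₂ i) M.adjugate)) f).im =
      (coeffN n M : ℝ) * ΨmC f (actIdxC q₁ q₂ M i) := by
    intro M hM
    have hM : IsUnit ((M.det : ℤ) : ZMod (q₁ * q₂)) := by rw [hdet M hM]; exact hunit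
    rw [actP_eC_adjugate q₁ q₂ hM, Complex.smul_im, Rat.smul_def, ΨmC]
  rw [Finset.sum_congr rfl hterm] at key'
  rw [key', Complex.smul_im, smul_eq_mul, Complex.im_ofReal_mul, ΨmC, Rat.smul_def]
  push_cast
  ring

end CPrime

end Summit.BirchSwinnertonDyer.BirchSwinnertonDyer.Theorems.KolyvaginDepthDoor.MSymbolCert

end
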